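import Literature.MathematicalPhysics.QuantumFieldTheory.Balaban1983to89.B6Prop22SeriesMultiLevelBox

/-!
# `Balaban1983to89.B6Prop22SeriesAdjMultiLevelBox` — [B6] PROPOSITION 2.2, THE CONVERGENCE CLAUSE «The random walk
representation (2.50) is convergent in the norms defined by these inequalities», FOR THE GENUINE `k`-LEVEL OPERATOR
`G′ = Δ′_a^{−1}` ON A BOX — PART 2: THE THIRD, FIFTH AND SIXTH ENTRIES OF (2.67) (the remainders of (2.50), resp. of its
transpose `G′ = Σ_n (Rᵀ)ⁿG′₀ᵀ`, decay like `2^{−N}` in the majorant norms of `G′∇^{η*}`, `‖ζG′∇^{η*}·‖_α`, `Δ^ηG′`; no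
existing module is touched; no fact is minted)

FRAMING (verbatim cell line):
statement-level skeleton of published theorems with citation tags; proofs where landed; nothing here is a claim about the Yang–Mills mass gap

Source under audit (cell pub-balaban / lit-balaban): T. Bałaban, *Propagators and renormalization transformations for
lattice gauge theories. II*, Commun. Math. Phys. **96** (1984) 223–250 [`Balaban1984PropagatorsII`, "B6"], p. 234
[PDF 12] (2.64)–(2.67), Proposition 2.2; p. 232 [PDF 10] (2.50)–(2.55); p. 225 [PDF 3] (2.13)–(2.14) (renders
`run/shared/lean/pub/pub-balaban/b2b-balaban-ref1/pages/1984-cmp96-propagators-rt-II/…-p003/p010/p012-x2.png`); [3] =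
T. Bałaban, *Regularity and decay of lattice Green's functions*, Commun. Math. Phys. **89** (1983) 571–597
[`Balaban1983RegularityDecay`], Theorem (1.9) p. 573.  PDF held: `paper:balaban1984-cmp96-propagators-rt-ii` (journal
page = PDF page + 222).  Unit `lit-balaban-p21` (Phase-2 proof seat p21 gen 12), HOME `run/shared/lean/pub/lit-balaban/`,
B6 fold owner r03 (rows **B6.Prop2.2**, **B6.Eq2.50**), referee ref-4.  Part 1 = `B6Prop22SeriesMultiLevelBox` (entries
1, 2, 4: the right fixed points `T = T₀ + T·R`).

## WHAT IS PRINTED (pp. 232, 234, verbatim up to notation)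

p. 232: «G′ = G′₀(I − R)^{−1} = G′₀ Σ_{n=0}^∞ Rⁿ. (2.50) … Both series above are convergent in the space L^∞, and in the
Hölder norm ‖·‖_{1,α} also.»; p. 234: «**Proposition 2.2.** If we have (2.1), (2.2) and M is sufficiently large, then the
operator G′ = Δ′_a^{−1} (a = 1) satisfies the inequalities |(G′λ)(x)|, |(∇^η_xG′λ)(x)|, |(G′∇^{η*}λ)(x)|, ‖ζ∇^ηG′λ‖_α,
‖ζG′∇^{η*}λ‖_α, |(Δ^ηG′λ)(x)| ≤ O(1)[(L^jη)², L^jη, L^jη, (L^jη)^{1−α}(‖ζ‖_α + |ζ|), (L^jη)^{1−α}(‖ζ‖_α + |ζ|), 1]·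
e^{−½δ₀d(y,y′)}|λ| … (2.67)  The random walk representation (2.50) is convergent in the norms defined by these
inequalities.»

## WHAT THIS FILE CERTIFIES (kernel-checked; setting of files 1–14 of the multi-level parametrix and of part 1)

For the genuine `k`-level operator (`G′ = gml`, `G′₀ = gZeroML`, `R = rML`, `∂_μ = dMat μ`, `Λ = levW D 1 = diag(L^{j(x)})`,
blocks `𝔅`/`blkOf`/`d` of `geom D`):
* §1 algebra: `leftPartialSum_add_remainder` — `T = (Σ_{n<N}Rtⁿ)T₀ + Rt^N·T` for any left fixed point `T = T₀ + Rt·T`;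
  `gml_mul_eq_leftPartialSum_add_remainder` — `G′∂ᵀ = (Σ_{n<N}(Rᵀ)ⁿ)G′₀ᵀ∂ᵀ + (Rᵀ)^N G′∂ᵀ` (and, with `∂ᵀ` replaced by
  `1`, the TRANSPOSED representation `G′ = Σ_{n<N}(Rᵀ)ⁿG′₀ᵀ + (Rᵀ)^NG′` of the symmetric `G′`); `transpose_gml_mul_pow` —
  `(G′R^N)ᵀ = (Rᵀ)^N G′`: the remainder of the transposed partial sums IS the transpose of the remainder of (2.50);
  `levW_conj_pow_mul` — `Λ^{−1}(Rᵀ)^N V = S^N Λ^{−1}V`, `S = Λ^{−1}RᵀΛ`; `liftR_mul`.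
* §2 THE CONJUGATED REMAINDERS (private master lemma `conjRemainder_majorant`): with `U = (1 − S)^{−1}` (row sums of `S`
  `≤ θc ≤ ½`, `B6Prop23Chain.isUnit_one_sub`), `Λ^{−1}(Rᵀ)^N G′∂ᵀ = (U S^N)·(Λ^{−1}G′₀ᵀ∂ᵀ)` (`S` and `U` commute), the
  tail `U S^N` of the chain of `U = 1 + U S` (part 1 `majorant_remainder_266W` with `G₀ = 1`) and the left convolution
  with the majorant of `Λ^{−1}G′₀ᵀ∂ᵀ` (file 9): majorant `C·2^{−N}·e^{−½δ₀d}`, for every rate cap `δe` a rate `δ₀ ≤ δe`.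
* §3 **THIRD ENTRY** `prop22_series_third_multiLevelBox`: there are `δ₀, C, M₀ > 0`, `N₀ ≥ 1` with, for every `k`,
  `M_h ≥ 3`, `L·M_h ≥ M₀`, `R ≥ 2L`, `RM ≥ N₀ + 1`, volume, nested family, weights in the windows (`a_{i+1} = aNext ℓ a_i c_i`),
  axis `μ` and EVERY `N`: `(Rᵀ)^N G′∂_μᵀ` has majorant `C·2^{−N}·L^{j}·e^{−½δ₀d(y,y′)}` (`N = 0`: the third entry itself).
* §4 **FIFTH ENTRY, PRINTED QUANTIFIER ORDER** `prop22_series_fifth_multiLevelBox_unif` (`∃ δ₀ M₀ N₀ ∀ α ∈ [0,1) ∃ C(α)`):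
  the lifted pair functional `D_α∘((Rᵀ)^N G′∂_μᵀ)` has majorant `C·2^{−N}·(L^{j})^{1−α}·e^{−½δ₀d}` on `pairs ⊕ sites`
  (`N = 0`: the lifted identity `T = T₀ + Ψ·Ṽ` of file 13; `N = n + 1`: `D_α∘(Rᵀ(Rᵀ)ⁿV) = Ψ · Λ^{−1}(Rᵀ)ⁿV`, §2); read
  back on the pairs in `prop22_series_fifth_pointwise_multiLevelBox_unif`.
* §5 **SIXTH ENTRY** `prop22_series_sixth_multiLevelBox`: `(−Δ^N)(G′R^N) = R^N − Q′*aQ′(G′R^N)` has majorant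
  `C·2^{−N}·e^{−½δ₀d}` (the remainder of part 1 in the first norm, the block average `Q′*aQ′` of file 7, the chain
  `R^N` (2.65)).

## HONEST SCOPE

The third and fifth norms are certified for the remainders `(Rᵀ)^N G′ = (G′R^N)ᵀ` of the TRANSPOSED representation
`G′ = Σ_n(Rᵀ)ⁿG′₀ᵀ` (which represents the symmetric `G′`; its partial sums are the transposes of those of (2.50)) — the
ordering in which the third and fifth entries themselves were certified (files 9, 13; two-level precedent
`B6Prop22AllTwoLevelBox.prop22_series_twoLevelBox`); the sixth norm for the remainders `G′R^N` of (2.50) itself.  The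
print's path expansion `Σ_ω` of (2.50) is the entrywise expansion of `G′₀Rⁿ`, not re-expanded here.  Otherwise as files
1–14: levels `1 … k` on a Neumann box, `m² = 0`, the asymmetric partition, `M_h ≥ 3`, `R ≥ 2L`, lattice units (`L^{j}`,
`(L^{j})^{1−α}`, `1` for «L^jη», «(L^jη)^{1−α}», «1»), `L`-dependent (2.61)-constant, «M sufficiently large» so that
`θc ≤ ½` (whence the ratio `½`), constants existential.  Nothing is inferred from the manuscript: every step is
kernel-checked.  NOT summit progress.
-/

namespace Literature.MathematicalPhysics.QuantumFieldTheory.Balaban1983to89.B6Prop22SeriesAdjMultiLevelBox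

open Matrix
open Literature.MathematicalPhysics.QuantumFieldTheory.Balaban1983to89.B4Reflection242 (boxDom)
open Literature.MathematicalPhysics.QuantumFieldTheory.Balaban1983to89.B4ContourShift (supNorm supNorm_nonneg)
open Literature.MathematicalPhysics.QuantumFieldTheory.Balaban1983to89.B4BoxCov237 (opBoxR)
open Literature.MathematicalPhysics.QuantumFieldTheory.Balaban1983to89.B6Ineq243TwoLevelBox (aNext)
open Literature.MathematicalPhysics.QuantumFieldTheory.Balaban1983to89.B6MultiLevelBoxOperator
open Literature.MathematicalPhysics.QuantumFieldTheory.Balaban1983to89.B6Eq238MultiLevelBox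
open Literature.MathematicalPhysics.QuantumFieldTheory.Balaban1983to89.B6Ineq249MultiLevelBox
open Literature.MathematicalPhysics.QuantumFieldTheory.Balaban1983to89.B6Geom246MultiLevelBox
open Literature.MathematicalPhysics.QuantumFieldTheory.Balaban1983to89.B6Prop22MultiLevelBox
open Literature.MathematicalPhysics.QuantumFieldTheory.Balaban1983to89.B6Prop22DerivMultiLevelBox (dMat)
open Literature.MathematicalPhysics.QuantumFieldTheory.Balaban1983to89.B6Prop22AdjMultiLevelBox (majorant_mul_left
  hasMajorant_one hasMajorant_diagonal_mul rowSum_le_of_hasMajorant gml_transpose levW fixedPoint_transpose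
  fixedPoint_conj sOp_majorant tZero_majorant)
open Literature.MathematicalPhysics.QuantumFieldTheory.Balaban1983to89.B6Prop22LapMultiLevelBox (vOp lap_mul_gml
  vOp_mulVec_abs_le)
open Literature.MathematicalPhysics.QuantumFieldTheory.Balaban1983to89.B6Prop22HolderMultiLevelBox (liftL liftR
  liftL_mul_liftR liftL_add hasMajorant_liftL hasMajorant_liftR rowBound_of_hasMajorant_liftL liftR_apply_inl
  liftR_apply_inr)
open Literature.MathematicalPhysics.QuantumFieldTheory.Balaban1983to89.B6Prop22DualHolderMultiLevelBox (BPair blkB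
  dualOp dualOp_apply dualOp_mul dual_identity levW_one_mul_neg_one)
open Literature.MathematicalPhysics.QuantumFieldTheory.Balaban1983to89.B6Prop22DualHolderMultiLevelBoxRateUnif
  (dualZero_rowBound_unif dualPsi_rowBound_unif)
open Literature.MathematicalPhysics.QuantumFieldTheory.Balaban1983to89.B6RandomWalk (HasMajorant BlockSupp
  hasMajorant_mono hasMajorant_add hasMajorant_mul Triangle254)
open Literature.MathematicalPhysics.QuantumFieldTheory.Balaban1983to89.B6Lemma21Repaired (Ineq261With Ineq263With)
open Literature.MathematicalPhysics.QuantumFieldTheory.Balaban1983to89.B6Ineq261LevelGap (K261 K261_nonneg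
  theta_lt_one_of_log)
open Literature.MathematicalPhysics.QuantumFieldTheory.Balaban1983to89.B6Prop23Chain (majorant_pow_265W
  majorant_G0_mul_265W majorant_of_fixedPoint_266W mat isUnit_one_sub)
open Literature.MathematicalPhysics.QuantumFieldTheory.Balaban1983to89.B6Prop22SeriesMultiLevelBox
  (majorant_remainder_266W prop22_series_first_multiLevelBox)

noncomputable section

variable {d : ℕ}

/-! ## §1 Algebra: left partial sums, the transposed representation, conjugation by the level weights, lifts -/

section Algebra

variable {X : Type*} [Fintype X] [DecidableEq X]

/-- the algebra of a LEFT fixed point: `T = (Σ_{n<N}Rtⁿ)·T₀ + Rt^N·T` for any `T = T₀ + Rt·T` (the transposed (2.50)).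
[cite: Balaban1984PropagatorsII, (2.50) p.232] -/
theorem leftPartialSum_add_remainder (T T₀ Rt : Matrix X X ℝ) (h : T = T₀ + Rt * T) (N : ℕ) :
    T = (∑ n ∈ Finset.range N, Rt ^ n) * T₀ + Rt ^ N * T := by
  induction N with
  | zero => simp
  | succ N ih =>
      calc T = (∑ n ∈ Finset.range N, Rt ^ n) * T₀ + Rt ^ N * T := ih
        _ = (∑ n ∈ Finset.range N, Rt ^ n) * T₀ + Rt ^ N * (T₀ + Rt * T) := by rw [← h]
        _ = (∑ n ∈ Finset.range (N + 1), Rt ^ n) * T₀ + Rt ^ (N + 1) * T := by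
            rw [Matrix.mul_add, Finset.sum_range_succ, Matrix.add_mul, ← Matrix.mul_assoc, ← pow_succ, add_assoc]

end Algebra

section Lift

variable {X Y : Type}

/-- `liftR` is multiplicative: `liftR (A·B) = liftR A · liftR B`. [cite: Balaban1984PropagatorsII, (2.52)–(2.55) p.232, dictionary] -/
theorem liftR_mul (A B : Module.End ℝ (X → ℝ)) : liftR (Y := Y) (A * B) = liftR A * liftR B := by
  apply LinearMap.ext
  intro f
  funext s
  cases s with
  | inl p => rw [Module.End.mul_apply, liftR_apply_inl, liftR_apply_inl]
  | inr x =>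
      rw [Module.End.mul_apply, liftR_apply_inr, liftR_apply_inr, Module.End.mul_apply]
      congr 1

end Lift

section KLevelAlgebra

variable {ℓ Mh k R : ℕ} {P : Fin (d + 1) → ℕ}

/-- **(2.50) TRANSPOSED, FOR THE GENUINE `k`-LEVEL OPERATOR, PARTIAL SUMS AND REMAINDER**: for every matrix `Dm`,
`G′·Dm = (Σ_{n<N}(Rᵀ)ⁿ)·G′₀ᵀDm + (Rᵀ)^N·(G′Dm)` (`Dm = ∂_μᵀ`: the third/fifth entries; `Dm = 1`: the transposed
representation `G′ = Σ_n(Rᵀ)ⁿG′₀ᵀ` of the symmetric `G′`). [cite: Balaban1984PropagatorsII, (2.50) p.232, (2.38) p.229, (2.66)–(2.67) p.234 (third entry)] -/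
theorem gml_mul_eq_leftPartialSum_add_remainder (D : Domains d ℓ Mh k P R) {a c : ℕ → ℝ} (hℓ : 1 ≤ ℓ)
    (hR : 2 * (ℓ + 1) ≤ R) (hP : ∀ μ, 1 ≤ P μ) (hMh : 1 ≤ Mh) (ha : ∀ i, 1 ≤ i → 0 < a i)
    (hcpos : ∀ i, 1 ≤ i → 0 < c i) (hac : ∀ i, 1 ≤ i → a (i + 1) = aNext ℓ (a i) (c i))
    (Dm : Matrix ↥(boxDom (N0 ℓ Mh k P)) ↥(boxDom (N0 ℓ Mh k P)) ℝ) (N : ℕ) :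
    gml (N0 ℓ Mh k P) ℓ k D.lev a * Dm
      = (∑ n ∈ Finset.range N, ((rML D a c hP)ᵀ) ^ n) * ((gZeroML D a c hP)ᵀ * Dm)
        + ((rML D a c hP)ᵀ) ^ N * (gml (N0 ℓ Mh k P) ℓ k D.lev a * Dm) :=
  leftPartialSum_add_remainder _ _ _ (fixedPoint_transpose D hℓ hR hP hMh ha hcpos hac Dm) N

/-- **THE REMAINDER OF THE TRANSPOSED PARTIAL SUMS IS THE TRANSPOSE OF THE REMAINDER OF (2.50)**:
`(G′R^N)ᵀ = (Rᵀ)^N G′` (`G′ᵀ = G′`). [cite: Balaban1984PropagatorsII, (2.50) p.232, (2.13)–(2.14) p.225 (symmetry)] -/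
theorem transpose_gml_mul_pow (D : Domains d ℓ Mh k P R) (a c : ℕ → ℝ) (hP : ∀ μ, 1 ≤ P μ) (N : ℕ) :
    (gml (N0 ℓ Mh k P) ℓ k D.lev a * rML D a c hP ^ N)ᵀ = ((rML D a c hP)ᵀ) ^ N * gml (N0 ℓ Mh k P) ℓ k D.lev a := by
  rw [Matrix.transpose_mul, Matrix.transpose_pow, gml_transpose]

/-- `Λ = diag(L^{j(y(x))})`. [folklore] -/
private theorem levW_one_eq_diagonal (D : Domains d ℓ Mh k P R) :
    levW D 1 = Matrix.diagonal (fun x => ((ℓ : ℝ) + 1) ^ (blkOf D x).1.1) := by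
  unfold levW
  refine congrArg Matrix.diagonal (funext fun x => ?_)
  rw [zpow_one]
  rfl

/-- `Λ(Λ^{−1}X) = X`. [folklore] -/
private theorem levW_cancel_left (D : Domains d ℓ Mh k P R)
    (Xm : Matrix ↥(boxDom (N0 ℓ Mh k P)) ↥(boxDom (N0 ℓ Mh k P)) ℝ) : levW D 1 * (levW D (-1) * Xm) = Xm := by
  rw [← Matrix.mul_assoc, levW_one_mul_neg_one, Matrix.one_mul]

/-- **CONJUGATING THE POWERS BY THE LEVEL WEIGHTS**: `Λ^{−1}·(Rt^N·V) = S^N·(Λ^{−1}V)` with `S = Λ^{−1}RtΛ`.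
[cite: Balaban1984PropagatorsII, (2.66)–(2.67) p.234 (third entry), dictionary] -/
theorem levW_conj_pow_mul (D : Domains d ℓ Mh k P R)
    (Rt V : Matrix ↥(boxDom (N0 ℓ Mh k P)) ↥(boxDom (N0 ℓ Mh k P)) ℝ) (N : ℕ) :
    levW D (-1) * (Rt ^ N * V) = (levW D (-1) * Rt * levW D 1) ^ N * (levW D (-1) * V) := by
  induction N with
  | zero => rw [pow_zero, pow_zero, Matrix.one_mul, Matrix.one_mul]
  | succ N ih =>
      rw [pow_succ', pow_succ', Matrix.mul_assoc (levW D (-1) * Rt * levW D 1), ← ih]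
      simp only [Matrix.mul_assoc, levW_cancel_left]

end KLevelAlgebra

/-! ## §2 The conjugated remainders `Λ^{−1}(Rᵀ)^N G′∂ᵀ = (U S^N)·Λ^{−1}G′₀ᵀ∂ᵀ` -/

section Conj

variable {ℓ Mh k R : ℕ} {P : Fin (d + 1) → ℕ}

/-- `mat (toLin' S) = S`. [folklore] -/
private theorem mat_toLin' {N : Fin (d + 1) → ℕ} (S : Matrix ↥(boxDom N) ↥(boxDom N) ℝ) (x z : ↥(boxDom N)) :
    mat (Matrix.toLin' S) x z = S x z := by
  unfold mat
  rw [Matrix.toLin'_apply, Matrix.mulVec_single_one]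
  rfl

/-- **THE CONJUGATED REMAINDERS** (master lemma of this file): for every rate cap `δe > 0` there are `0 < δ₀ ≤ δe`, a
(2.61)-constant `c₁ ≥ 0`, `C, M₀ > 0`, `N₀ ≥ 1` such that for every `k`, `M_h ≥ 3`, `L·M_h ≥ M₀`, `R ≥ 2L`,
`RM ≥ N₀ + 1`, volume, nested family, weights in the windows: (2.61) holds on the box at rate `δ₀` with `α = ½` and
constant `c₁`, and for every axis `μ` and every `N` the conjugated remainder `Λ^{−1}(Rᵀ)^N G′∂_μᵀ = (U S^N)·(Λ^{−1}G′₀ᵀ∂_μᵀ)`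
(`U = (1 − S)^{−1}`, `S = Λ^{−1}RᵀΛ`, `S` and `U` commute) has majorant `C·2^{−N}·e^{−½δ₀d(y,y′)}` — the tail `U S^N` of
the chain of `U = 1 + U·S` (part 1, `G₀ = 1`, `θc ≤ ½`) convolved on the left with the majorant of `Λ^{−1}G′₀ᵀ∂ᵀ`.
[cite: Balaban1984PropagatorsII, (2.64)–(2.66) p.234, Proposition 2.2 p.234 (third entry; convergence clause)] -/
private theorem conjRemainder_majorant (d ℓ : ℕ) (hℓ : 1 ≤ ℓ) (aminus aplus a2minus a2plus : ℝ) (ha : 0 < aminus)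
    (ha2 : 0 < a2minus) {δe : ℝ} (hδe : 0 < δe) :
    ∃ δ₀ c₁ C M₀ : ℝ, ∃ N₀ : ℕ, 0 < δ₀ ∧ δ₀ ≤ δe ∧ 0 ≤ c₁ ∧ 0 < C ∧ 0 < M₀ ∧ 0 < N₀ ∧
      ∀ (k Mh R : ℕ), 3 ≤ Mh → M₀ ≤ ((ℓ : ℝ) + 1) * Mh → 2 * (ℓ + 1) ≤ R → N₀ + 1 ≤ R * ((ℓ + 1) * Mh) →
      ∀ (P : Fin (d + 1) → ℕ) (hP : ∀ μ, 1 ≤ P μ) (D : Domains d ℓ Mh k P R) (a c : ℕ → ℝ),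
        (∀ i, 1 ≤ i → aminus ≤ a i ∧ a i ≤ aplus) → (∀ i, 1 ≤ i → a2minus ≤ c i ∧ c i ≤ a2plus) →
        (∀ i, 1 ≤ i → a (i + 1) = aNext ℓ (a i) (c i)) →
        Ineq261With c₁ (geom D) δ₀ (1 / 2) ∧ ∀ (μ : Fin (d + 1)) (N : ℕ),
          HasMajorant (g := geom D) (blkOf D)
            (Matrix.toLin' (levW D (-1) * (((rML D a c hP)ᵀ) ^ N
              * (gml (N0 ℓ Mh k P) ℓ k D.lev a * (dMat (N0 ℓ Mh k P) μ)ᵀ))))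
            (fun y y' => C * (1 / 2) ^ N * Real.exp (-((1 - 1 / 2) * δ₀ * (geom D).dist y y'))) := by
  obtain ⟨δ₄, K', hδ₄, hK', hSmaj⟩ := sOp_majorant d ℓ hℓ aminus aplus a2minus a2plus ha ha2
  obtain ⟨δ₅, A, hδ₅, hA, hTmaj⟩ := tZero_majorant d ℓ hℓ aminus aplus a2minus a2plus ha ha2
  have hL0 : (0 : ℝ) < (ℓ : ℝ) + 1 := by positivity
  have hL1 : (1 : ℝ) ≤ (ℓ : ℝ) + 1 := by linarith [(Nat.cast_nonneg ℓ : (0 : ℝ) ≤ ℓ)]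
  -- the rate `δ₀ = min(min(δ₄, δ₅)/(d+1), δe)` and the (2.59)-threshold `N₀`
  set δ₀ : ℝ := min (min δ₄ δ₅ / (d + 1)) δe with hδ₀
  have hδ₀pos : 0 < δ₀ := by rw [hδ₀]; exact lt_min (div_pos (lt_min hδ₄ hδ₅) (by positivity)) hδe
  have hδ₀e : δ₀ ≤ δe := by rw [hδ₀]; exact min_le_right _ _
  have hδ₀m : δ₀ ≤ min δ₄ δ₅ / (d + 1) := by rw [hδ₀]; exact min_le_left _ _
  set N₀ : ℕ := ⌈4 * ((d : ℝ) + 1) * ((ℓ : ℝ) + 1) / (1 / 2 * δ₀)⌉₊ + 1 with hN₀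
  have hN₀pos : 0 < N₀ := by rw [hN₀]; omega
  have hθlt : Real.exp (-(1 / 2 * δ₀)) * ((ℓ : ℝ) + 1) ^ ((2 * (d + 1 : ℕ) : ℝ) / N₀) < 1 := by
    refine theta_lt_one_of_log hL0 hN₀pos ?_
    have hlog : Real.log ((ℓ : ℝ) + 1) ≤ (ℓ : ℝ) + 1 := (Real.log_le_sub_one_of_pos hL0).trans (by linarith)
    have hN₀ge : 4 * ((d : ℝ) + 1) * ((ℓ : ℝ) + 1) / (1 / 2 * δ₀) < (N₀ : ℝ) := by
      rw [hN₀]; push_cast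
      exact lt_of_le_of_lt (Nat.le_ceil _) (by linarith)
    have hσ : (0 : ℝ) < 1 / 2 * δ₀ := by positivity
    rw [div_lt_iff₀ hσ] at hN₀ge
    push_cast
    nlinarith [mul_nonneg (by positivity : (0 : ℝ) ≤ 2 * ((d : ℝ) + 1)) (Real.log_nonneg hL1)]
  -- the (2.61)-constant and «M sufficiently large» (`M_h ≥ 2K′c + 1`, stated through `L·M_h`)
  set cK : ℝ := K261 N₀ (d + 1) ((ℓ : ℝ) + 1) 1 (1 / 2 * δ₀) with hcK
  have hcK0 : 0 ≤ cK := K261_nonneg (by positivity) zero_le_one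
  set M₀ : ℝ := ((ℓ : ℝ) + 1) * (2 * K' * cK + 1) with hM₀
  refine ⟨δ₀, cK, 2 * A * cK * cK + 1, M₀, N₀, hδ₀pos, hδ₀e, hcK0, by positivity, by positivity, hN₀pos, ?_⟩
  intro k Mh R hMh hM hR hRM P hP D a c haw hcw hac
  have hMh1 : 1 ≤ Mh := le_trans (by norm_num) hMh
  have hMhr : (1 : ℝ) ≤ Mh := by exact_mod_cast hMh1
  have hMh0 : (0 : ℝ) < Mh := by linarith
  have hMhge : 2 * K' * cK + 1 ≤ (Mh : ℝ) := le_of_mul_le_mul_left (by rw [hM₀] at hM; exact hM) hL0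
  have hapos : ∀ j, 1 ≤ j → 0 < a j := fun j hj => lt_of_lt_of_le ha (haw j hj).1
  have hcpos : ∀ j, 1 ≤ j → 0 < c j := fun j hj => lt_of_lt_of_le ha2 (hcw j hj).1
  -- geometry of the box
  obtain ⟨-, h261, -, h263⟩ := lemma21_box D hMh1 hP hN₀pos hRM hδ₀pos.le (α := 1 / 2) (by norm_num)
    (by norm_num) hθlt
  obtain ⟨htri, hrefl, hdnn⟩ := triangle_refl_nonneg D hMh1 hP
  have hsymm : ∀ a b : (geom D).Site, (geom D).dist a b = (geom D).dist b a := fun a b => by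
    show (((bond D).dist a b : ℕ) : ℝ) = (((bond D).dist b a : ℕ) : ℝ)
    rw [SimpleGraph.dist_comm]
  have hαδ : (0 : ℝ) ≤ (1 - 1 / 2) * δ₀ := by nlinarith [hδ₀pos.le]
  refine ⟨h261, fun μ N => ?_⟩
  -- the majorants of `S` and `T̃₀` at the common rate `δ₀`
  set θ : ℝ := K' / Mh with hθ
  have hθ0 : 0 ≤ θ := by positivity
  have hrate : ∀ (δ : ℝ), min δ₄ δ₅ ≤ δ → ∀ y y' : (geom D).Site,
      Real.exp (-(δ / (d + 1) * (geom D).dist y y')) ≤ Real.exp (-(δ₀ * (geom D).dist y y')) := by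
    intro δ hδ y y'
    rw [Real.exp_le_exp, neg_le_neg_iff]
    have h1 : δ₀ ≤ δ / (d + 1) := hδ₀m.trans (div_le_div_of_nonneg_right hδ (by positivity))
    exact mul_le_mul_of_nonneg_right h1 (hdnn y y')
  have hSm : HasMajorant (g := geom D) (blkOf D)
      (Matrix.toLin' (levW D (-1) * (rML D a c hP)ᵀ * levW D 1))
      (fun y y' => θ * Real.exp (-(δ₀ * (geom D).dist y y'))) :=
    hasMajorant_mono (blkOf D) (hSmaj k Mh R hMh hR P hP D a c haw hcw) fun y y' =>
      mul_le_mul_of_nonneg_left (hrate δ₄ (min_le_left _ _) y y') hθ0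
  have hT0m : HasMajorant (g := geom D) (blkOf D)
      (Matrix.toLin' (levW D (-1) * (gZeroML D a c hP)ᵀ * (dMat (N0 ℓ Mh k P) μ)ᵀ))
      (fun y y' => A * Real.exp (-(δ₀ * (geom D).dist y y'))) :=
    hasMajorant_mono (blkOf D) (hTmaj k Mh R hMh hR P hP D a c haw hcw μ) fun y y' =>
      mul_le_mul_of_nonneg_left (hrate δ₅ (min_le_right _ _) y y') hA.le
  -- the smallness `θ·c ≤ ½` and the row sums of `S`
  have hsmall : θ * cK ≤ 1 / 2 := by
    rw [hθ, div_mul_eq_mul_div, div_le_iff₀ hMh0]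
    nlinarith
  have hsmall' : θ * cK < 1 := by linarith
  have hq0 : 0 ≤ θ * cK := mul_nonneg hθ0 hcK0
  have hq1 : 0 < 1 - θ * cK := by linarith
  have hrow : ∀ x, ∑ z, |mat (Matrix.toLin' (levW D (-1) * (rML D a c hP)ᵀ * levW D 1)) x z| ≤ θ * cK := by
    intro x
    simp_rw [mat_toLin']
    refine (rowSum_le_of_hasMajorant (g := geom D) (blkOf D) hSm x).trans ?_
    calc ∑ y' : (geom D).Site, θ * Real.exp (-(δ₀ * (geom D).dist (blkOf D x) y'))
        ≤ ∑ y' : (geom D).Site, θ * Real.exp (-(1 / 2 * δ₀ * (geom D).dist (blkOf D x) y')) :=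
          Finset.sum_le_sum fun y' _ => mul_le_mul_of_nonneg_left
            (Real.exp_le_exp.2 (by nlinarith [hdnn (blkOf D x) y', hδ₀pos.le])) hθ0
      _ = θ * ∑ y' : (geom D).Site, Real.exp (-(1 / 2 * δ₀ * (geom D).dist (blkOf D x) y')) := by
          rw [Finset.mul_sum]
      _ ≤ θ * cK := mul_le_mul_of_nonneg_left (h261 (blkOf D x)) hθ0
  -- `U = (1 − S)^{−1} = 1 + U·S`; `S` and `U` commute
  obtain ⟨u, hu⟩ := isUnit_one_sub hsmall' hrow
  set U : Module.End ℝ (↥(boxDom (N0 ℓ Mh k P)) → ℝ) := ↑u⁻¹ with hUdef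
  have hUinv : U * (1 - Matrix.toLin' (levW D (-1) * (rML D a c hP)ᵀ * levW D 1)) = 1 := by
    rw [hUdef, ← hu, Units.inv_mul]
  have hinvU : (1 - Matrix.toLin' (levW D (-1) * (rML D a c hP)ᵀ * levW D 1)) * U = 1 := by
    rw [hUdef, ← hu, Units.mul_inv]
  have hfixU : U = 1 + U * Matrix.toLin' (levW D (-1) * (rML D a c hP)ᵀ * levW D 1) := by
    have h := hUinv
    rw [mul_sub, mul_one, sub_eq_iff_eq_add] at h
    exact h
  have hcomm : Matrix.toLin' (levW D (-1) * (rML D a c hP)ᵀ * levW D 1) * U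
      = U * Matrix.toLin' (levW D (-1) * (rML D a c hP)ᵀ * levW D 1) := by
    have e1 : Matrix.toLin' (levW D (-1) * (rML D a c hP)ᵀ * levW D 1) * U = U - 1 := by
      have h := hinvU
      rw [sub_mul, one_mul] at h
      rw [← h]; abel
    have e2 : U * Matrix.toLin' (levW D (-1) * (rML D a c hP)ᵀ * levW D 1) = U - 1 := by
      have h := hUinv
      rw [mul_sub, mul_one] at h
      rw [← h]; abel
    rw [e1, e2]
  have hcommN : ∀ n : ℕ, Matrix.toLin' (levW D (-1) * (rML D a c hP)ᵀ * levW D 1) ^ n * U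
      = U * Matrix.toLin' (levW D (-1) * (rML D a c hP)ᵀ * levW D 1) ^ n := fun n =>
    ((show Commute (Matrix.toLin' (levW D (-1) * (rML D a c hP)ᵀ * levW D 1)) U from hcomm).pow_left n).eq
  -- the tails `U·S^N` of the chain of `U = 1 + U·S` (part 1, `G₀ = 1`)
  have hUS : HasMajorant (g := geom D) (blkOf D)
      (U * Matrix.toLin' (levW D (-1) * (rML D a c hP)ᵀ * levW D 1) ^ N)
      (fun y y' => cK * (θ * cK) ^ N * (1 - θ * cK)⁻¹ * Real.exp (-((1 - 1 / 2) * δ₀ * (geom D).dist y y'))) := by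
    have h := majorant_remainder_266W (g := geom D) (blkOf D) cK δ₀ (1 / 2) θ 1 (fun _ => (1 : ℝ)) zero_le_one
      (fun _ => zero_le_one) hθ0 hcK0 hαδ htri hrefl hdnn h261 h263 hsmall' (hasMajorant_one (blkOf D) δ₀ hrefl)
      hSm hfixU N
    exact hasMajorant_mono (g := geom D) (blkOf D) h fun y y' => le_of_eq (by ring)
  -- `Λ^{−1}G′∂ᵀ = U·T̃₀` (the conjugated fixed point `T̃ = T̃₀ + S·T̃`, as in the third entry)
  have hconj := fixedPoint_conj D (c := c) hℓ hR hP hMh1 hapos hcpos hac (dMat (N0 ℓ Mh k P) μ)ᵀ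
  have hconjL : Matrix.toLin' (levW D (-1) * (gml (N0 ℓ Mh k P) ℓ k D.lev a * (dMat (N0 ℓ Mh k P) μ)ᵀ))
      = Matrix.toLin' (levW D (-1) * (gZeroML D a c hP)ᵀ * (dMat (N0 ℓ Mh k P) μ)ᵀ)
        + Matrix.toLin' (levW D (-1) * (rML D a c hP)ᵀ * levW D 1)
          * Matrix.toLin' (levW D (-1) * (gml (N0 ℓ Mh k P) ℓ k D.lev a * (dMat (N0 ℓ Mh k P) μ)ᵀ)) := by
    conv_lhs => rw [hconj]
    rw [map_add, Module.End.mul_eq_comp, ← Matrix.toLin'_mul, Matrix.mul_assoc (levW D (-1)) ((gZeroML D a c hP)ᵀ)]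
  have hTt : Matrix.toLin' (levW D (-1) * (gml (N0 ℓ Mh k P) ℓ k D.lev a * (dMat (N0 ℓ Mh k P) μ)ᵀ))
      = U * Matrix.toLin' (levW D (-1) * (gZeroML D a c hP)ᵀ * (dMat (N0 ℓ Mh k P) μ)ᵀ) := by
    have h1 : (1 - Matrix.toLin' (levW D (-1) * (rML D a c hP)ᵀ * levW D 1))
        * Matrix.toLin' (levW D (-1) * (gml (N0 ℓ Mh k P) ℓ k D.lev a * (dMat (N0 ℓ Mh k P) μ)ᵀ))
        = Matrix.toLin' (levW D (-1) * (gZeroML D a c hP)ᵀ * (dMat (N0 ℓ Mh k P) μ)ᵀ) := by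
      rw [sub_mul, one_mul, sub_eq_iff_eq_add]
      exact hconjL
    calc Matrix.toLin' (levW D (-1) * (gml (N0 ℓ Mh k P) ℓ k D.lev a * (dMat (N0 ℓ Mh k P) μ)ᵀ))
        = (U * (1 - Matrix.toLin' (levW D (-1) * (rML D a c hP)ᵀ * levW D 1)))
            * Matrix.toLin' (levW D (-1) * (gml (N0 ℓ Mh k P) ℓ k D.lev a * (dMat (N0 ℓ Mh k P) μ)ᵀ)) := by
          rw [hUinv, one_mul]
      _ = U * Matrix.toLin' (levW D (-1) * (gZeroML D a c hP)ᵀ * (dMat (N0 ℓ Mh k P) μ)ᵀ) := by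
          rw [mul_assoc, h1]
  -- the conjugated remainder as an operator: `Λ^{−1}(Rᵀ)^N G′∂ᵀ = S^N·(U·T̃₀) = (U·S^N)·T̃₀`
  have hrem : Matrix.toLin' (levW D (-1) * (((rML D a c hP)ᵀ) ^ N
      * (gml (N0 ℓ Mh k P) ℓ k D.lev a * (dMat (N0 ℓ Mh k P) μ)ᵀ)))
      = (U * Matrix.toLin' (levW D (-1) * (rML D a c hP)ᵀ * levW D 1) ^ N)
        * Matrix.toLin' (levW D (-1) * (gZeroML D a c hP)ᵀ * (dMat (N0 ℓ Mh k P) μ)ᵀ) := by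
    rw [levW_conj_pow_mul, Matrix.toLin'_mul, Matrix.toLin'_pow, hTt, ← Module.End.mul_eq_comp, ← mul_assoc,
      hcommN N]
  rw [hrem]
  have hprod := majorant_mul_left (blkOf D) hαδ htri hsymm h261 (r := cK * (θ * cK) ^ N * (1 - θ * cK)⁻¹)
    (A := A) (by positivity) hA.le hUS hT0m
  refine hasMajorant_mono (g := geom D) (blkOf D) hprod fun y y' => ?_
  -- constants: `c (θc)^N (1 − θc)^{−1} A c ≤ (2Ac² + 1)·2^{−N}`
  have hinv : (1 - θ * cK)⁻¹ ≤ 2 := by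
    rw [inv_le_comm₀ hq1 (by norm_num)]; linarith
  have hpow : (θ * cK) ^ N ≤ (1 / 2) ^ N := pow_le_pow_left₀ hq0 hsmall N
  have he0 : 0 ≤ Real.exp (-((1 - 1 / 2) * δ₀ * (geom D).dist y y')) := (Real.exp_pos _).le
  have h2 : cK * (1 - θ * cK)⁻¹ * A * cK ≤ 2 * A * cK * cK + 1 := by
    have : cK * (1 - θ * cK)⁻¹ * A * cK ≤ cK * 2 * A * cK :=
      mul_le_mul_of_nonneg_right (mul_le_mul_of_nonneg_right (mul_le_mul_of_nonneg_left hinv hcK0) hA.le) hcK0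
    linarith
  have h1 : cK * (θ * cK) ^ N * (1 - θ * cK)⁻¹ * A * cK ≤ (2 * A * cK * cK + 1) * (1 / 2) ^ N := by
    calc cK * (θ * cK) ^ N * (1 - θ * cK)⁻¹ * A * cK = (cK * (1 - θ * cK)⁻¹ * A * cK) * (θ * cK) ^ N := by ring
      _ ≤ (2 * A * cK * cK + 1) * (1 / 2) ^ N := mul_le_mul h2 hpow (pow_nonneg hq0 N) (by positivity)
  exact mul_le_mul_of_nonneg_right h1 he0

end Conj

/-! ## §3 The third entry: the remainders `(Rᵀ)^N G′∂ᵀ` of the transposed representation -/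

section Third

variable {ℓ Mh k R : ℕ} {P : Fin (d + 1) → ℕ}

/-- **[B6] PROPOSITION 2.2, CONVERGENCE CLAUSE, THIRD ENTRY (`G′∇^{η*}λ`), GENUINE `k`-LEVEL OPERATOR**: there are
`δ₀, C, M₀ > 0`, `N₀ ≥ 1` (functions of `d`, `ℓ`, the windows) such that for every `k`, `M_h ≥ 3` with `L·M_h ≥ M₀`, `R ≥ 2L`
with `RM ≥ N₀ + 1`, volume, nested family `D` (2.1)–(2.2), weights in the windows with `a_{i+1} = aNext ℓ a_i c_i`, axis `μ`
and EVERY `N`: the remainder `(Rᵀ)^N G′∂_μᵀ = (G′ − Σ_{n<N}(Rᵀ)ⁿG′₀ᵀ)∂_μᵀ = (G′R^N)ᵀ∂_μᵀ` has majorant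
`C·2^{−N}·L^{j}·e^{−½δ₀d(y,y′)}` on the blocks (`N = 0`: the third entry itself) — the partial sums of the transposed
representation converge geometrically in the norm of the third entry of (2.67) (§2 and `(Rᵀ)^N G′∂ᵀ = Λ·(U S^N)·Λ^{−1}G′₀ᵀ∂ᵀ`).
[cite: Balaban1984PropagatorsII, Proposition 2.2 p.234 («The random walk representation (2.50) is convergent in the norms defined by these inequalities»; third entry «L^jη»), (2.50) p.232, (2.64)–(2.66) p.234] -/
theorem prop22_series_third_multiLevelBox (d ℓ : ℕ) (hℓ : 1 ≤ ℓ) (aminus aplus a2minus a2plus : ℝ) (ha : 0 < aminus)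
    (ha2 : 0 < a2minus) :
    ∃ δ₀ C M₀ : ℝ, ∃ N₀ : ℕ, 0 < δ₀ ∧ 0 < C ∧ 0 < M₀ ∧ 0 < N₀ ∧
      ∀ (k Mh R : ℕ), 3 ≤ Mh → M₀ ≤ ((ℓ : ℝ) + 1) * Mh → 2 * (ℓ + 1) ≤ R → N₀ + 1 ≤ R * ((ℓ + 1) * Mh) →
      ∀ (P : Fin (d + 1) → ℕ) (hP : ∀ μ, 1 ≤ P μ) (D : Domains d ℓ Mh k P R) (a c : ℕ → ℝ),
        (∀ i, 1 ≤ i → aminus ≤ a i ∧ a i ≤ aplus) → (∀ i, 1 ≤ i → a2minus ≤ c i ∧ c i ≤ a2plus) →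
        (∀ i, 1 ≤ i → a (i + 1) = aNext ℓ (a i) (c i)) → ∀ (μ : Fin (d + 1)) (N : ℕ),
        HasMajorant (g := geom D) (blkOf D)
          (Matrix.toLin' (((rML D a c hP)ᵀ) ^ N * (gml (N0 ℓ Mh k P) ℓ k D.lev a * (dMat (N0 ℓ Mh k P) μ)ᵀ)))
          (fun y y' => C * (1 / 2) ^ N * ((ℓ : ℝ) + 1) ^ y.1.1 * Real.exp (-(δ₀ / 2 * (geom D).dist y y'))) := by
  obtain ⟨δ₀, c₁, C, M₀, N₀, hδ₀, -, -, hC, hM₀, hN₀, h⟩ :=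
    conjRemainder_majorant d ℓ hℓ aminus aplus a2minus a2plus ha ha2 one_pos
  refine ⟨δ₀, C, M₀, N₀, hδ₀, hC, hM₀, hN₀, ?_⟩
  intro k Mh R hMh hM hR hRM P hP D a c haw hcw hac μ N
  obtain ⟨-, hmaj⟩ := h k Mh R hMh hM hR hRM P hP D a c haw hcw hac
  have hW : ((rML D a c hP)ᵀ) ^ N * (gml (N0 ℓ Mh k P) ℓ k D.lev a * (dMat (N0 ℓ Mh k P) μ)ᵀ)
      = Matrix.diagonal (fun x => ((ℓ : ℝ) + 1) ^ (blkOf D x).1.1)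
        * (levW D (-1) * (((rML D a c hP)ᵀ) ^ N * (gml (N0 ℓ Mh k P) ℓ k D.lev a * (dMat (N0 ℓ Mh k P) μ)ᵀ))) := by
    rw [← levW_one_eq_diagonal, levW_cancel_left]
  rw [hW]
  refine hasMajorant_mono (g := geom D) (blkOf D)
    (hasMajorant_diagonal_mul (g := geom D) (blkOf D) (fun y : ↥(bset D) => ((ℓ : ℝ) + 1) ^ y.1.1)
      (fun y => by positivity) _ (hmaj μ N)) fun y y' => ?_
  have he : Real.exp (-((1 - 1 / 2) * δ₀ * (geom D).dist y y')) = Real.exp (-(δ₀ / 2 * (geom D).dist y y')) := by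
    congr 1; ring
  rw [he]
  exact le_of_eq (by ring)

end Third

/-! ## §4 The fifth entry (the lifted Hölder functional of `G′∇^{η*}`), printed quantifier order -/

section Fifth

variable {ℓ Mh k R : ℕ} {P : Fin (d + 1) → ℕ}

/-- **[B6] PROPOSITION 2.2, CONVERGENCE CLAUSE, FIFTH ENTRY (`‖ζG′∇^{η*}λ‖_α`), GENUINE `k`-LEVEL OPERATOR, PRINTED
QUANTIFIER ORDER**: there are `δ₀, M₀ > 0`, `N₀ ≥ 1` such that for every `0 ≤ α < 1` there is `C = C(α) > 0` with, for every
`k`, `M_h ≥ 3`, `L·M_h ≥ M₀`, `R ≥ 2L`, `RM ≥ N₀ + 1`, volume, nested family, weights in the windows (`a_{i+1} = aNext ℓ a_i c_i`),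
axis `μ` and EVERY `N`: the lifted pair functional `D_α∘((Rᵀ)^N G′∂_μᵀ)` of the remainder `(Rᵀ)^N G′∂_μᵀ = (G′R^N)ᵀ∂_μᵀ` has
majorant `C·2^{−N}·(L^{j})^{1−α}·e^{−½δ₀d}` on `pairs ⊕ sites` (`N = 0`: the lifted identity `T = T₀ + Ψ·Ṽ` of file 13 and
§2; `N = n + 1`: `D_α∘(Rᵀ·(Rᵀ)ⁿG′∂ᵀ) = Ψ·Λ^{−1}(Rᵀ)ⁿG′∂ᵀ` with `Ψ = D_α∘(RᵀΛ)`, §2, left convolution) — the Hölder norm of the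
partial sums of the transposed representation converges geometrically; «δ₀» does not depend on `α`.
[cite: Balaban1984PropagatorsII, Proposition 2.2 p.234 (convergence clause; fifth entry «(L^jη)^{1−α}(‖ζ‖_α + |ζ|)»), (2.50) p.232, (2.64)–(2.66) p.234; Balaban1983RegularityDecay, Theorem (1.9) p.573] -/
theorem prop22_series_fifth_multiLevelBox_unif (d ℓ : ℕ) (hℓ : 1 ≤ ℓ) (aminus aplus a2minus a2plus : ℝ)
    (ha : 0 < aminus) (ha2 : 0 < a2minus) :
    ∃ δ₀ M₀ : ℝ, ∃ N₀ : ℕ, 0 < δ₀ ∧ 0 < M₀ ∧ 0 < N₀ ∧ ∀ (α : ℝ), 0 ≤ α → α < 1 → ∃ C : ℝ, 0 < C ∧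
      ∀ (k Mh R : ℕ), 3 ≤ Mh → M₀ ≤ ((ℓ : ℝ) + 1) * Mh → 2 * (ℓ + 1) ≤ R → N₀ + 1 ≤ R * ((ℓ + 1) * Mh) →
      ∀ (P : Fin (d + 1) → ℕ) (hP : ∀ μ, 1 ≤ P μ) (D : Domains d ℓ Mh k P R) (a c : ℕ → ℝ),
        (∀ i, 1 ≤ i → aminus ≤ a i ∧ a i ≤ aplus) → (∀ i, 1 ≤ i → a2minus ≤ c i ∧ c i ≤ a2plus) →
        (∀ i, 1 ≤ i → a (i + 1) = aNext ℓ (a i) (c i)) → ∀ (μ : Fin (d + 1)) (N : ℕ),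
        HasMajorant (g := geom D) (Sum.elim (blkB D) (blkOf D))
          (liftL (dualOp D α (((rML D a c hP)ᵀ) ^ N
            * (gml (N0 ℓ Mh k P) ℓ k D.lev a * (dMat (N0 ℓ Mh k P) μ)ᵀ))))
          (fun y y' => C * (1 / 2) ^ N * (((ℓ : ℝ) + 1) ^ y.1.1) ^ (1 - α)
            * Real.exp (-(δ₀ / 2 * (geom D).dist y y'))) := by
  obtain ⟨δZ, hδZ, hZA⟩ := dualZero_rowBound_unif d ℓ hℓ aminus aplus a2minus a2plus ha ha2
  obtain ⟨δΨ, hδΨ, hΨA⟩ := dualPsi_rowBound_unif d ℓ hℓ aminus aplus a2minus a2plus ha ha2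
  have hδe : 0 < min δZ δΨ / (d + 1) := div_pos (lt_min hδZ hδΨ) (by positivity)
  obtain ⟨δ₀, c₁, C, M₀, N₀, hδ₀, hδ₀e, hc₁, hC, hM₀, hN₀, h⟩ :=
    conjRemainder_majorant d ℓ hℓ aminus aplus a2minus a2plus ha ha2 hδe
  have hδ₀Z : δ₀ ≤ δZ / (d + 1) := hδ₀e.trans (div_le_div_of_nonneg_right (min_le_left _ _) (by positivity))
  have hδ₀Ψ : δ₀ ≤ δΨ / (d + 1) := hδ₀e.trans (div_le_div_of_nonneg_right (min_le_right _ _) (by positivity))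
  refine ⟨δ₀, M₀, N₀, hδ₀, hM₀, hN₀, fun α hα0 hα1 => ?_⟩
  obtain ⟨AZ, hAZ, hZ⟩ := hZA α hα0 hα1
  obtain ⟨AΨ, hAΨ, hΨ⟩ := hΨA α hα0 hα1
  refine ⟨AZ + 2 * AΨ * c₁ * C + 1, by positivity, ?_⟩
  intro k Mh R hMh hM hR hRM P hP D a c haw hcw hac μ N
  have hMh1 : 1 ≤ Mh := le_trans (by norm_num) hMh
  have hMhr : (1 : ℝ) ≤ Mh := by exact_mod_cast hMh1
  have hapos : ∀ j, 1 ≤ j → 0 < a j := fun j hj => lt_of_lt_of_le ha (haw j hj).1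
  have hcpos : ∀ j, 1 ≤ j → 0 < c j := fun j hj => lt_of_lt_of_le ha2 (hcw j hj).1
  obtain ⟨h261, hmaj⟩ := h k Mh R hMh hM hR hRM P hP D a c haw hcw hac
  obtain ⟨htri, -, hdnn⟩ := triangle_refl_nonneg D hMh1 hP
  have hαδ : (0 : ℝ) ≤ (1 - 1 / 2) * δ₀ := by nlinarith [hδ₀.le]
  have hACC : 0 ≤ AΨ * c₁ * C := by positivity
  -- `Ψ = D_α∘(RᵀΛ)` lifted, at the full rate `δ₀`
  have hΨm : HasMajorant (g := geom D) (Sum.elim (blkB D) (blkOf D))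
      (liftL (dualOp D α ((rML D a c hP)ᵀ * levW D 1)))
      (fun y y' => AΨ * (((ℓ : ℝ) + 1) ^ y.1.1) ^ (1 - α) * Real.exp (-(δ₀ * (geom D).dist y y'))) := by
    refine hasMajorant_liftL (g := geom D) (blkOf D) (blkB D)
      (K := fun y y' => AΨ * (((ℓ : ℝ) + 1) ^ y.1.1) ^ (1 - α) * Real.exp (-(δ₀ * (geom D).dist y y')))
      (fun y y' => by positivity) fun y' lam B hlam p => ?_
    refine (hΨ k Mh R hMh hR P hP D a c haw hcw y' lam B hlam p).trans ?_
    refine mul_le_mul_of_nonneg_right ?_ hlam.nonneg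
    have h1 : AΨ / Mh ≤ AΨ := div_le_self hAΨ.le hMhr
    have h2 : Real.exp (-(δΨ / (d + 1) * (geom D).dist (blkB D p) y'))
        ≤ Real.exp (-(δ₀ * (geom D).dist (blkB D p) y')) :=
      Real.exp_le_exp.2 (by nlinarith [hdnn (blkB D p) y', hδ₀Ψ])
    have hP0 : 0 ≤ (((ℓ : ℝ) + 1) ^ (blkB D p).1.1) ^ (1 - α) := Real.rpow_nonneg (by positivity) _
    exact mul_le_mul (mul_le_mul_of_nonneg_right h1 hP0) h2 (Real.exp_pos _).le (by positivity)
  -- `T₀ = D_α∘(G′₀ᵀ∂ᵀ)` lifted, rate weakened to `½δ₀`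
  have hZm : HasMajorant (g := geom D) (Sum.elim (blkB D) (blkOf D))
      (liftL (dualOp D α ((gZeroML D a c hP)ᵀ * (dMat (N0 ℓ Mh k P) μ)ᵀ)))
      (fun y y' => AZ * (((ℓ : ℝ) + 1) ^ y.1.1) ^ (1 - α)
        * Real.exp (-((1 - 1 / 2) * δ₀ * (geom D).dist y y'))) := by
    refine hasMajorant_liftL (g := geom D) (blkOf D) (blkB D)
      (K := fun y y' => AZ * (((ℓ : ℝ) + 1) ^ y.1.1) ^ (1 - α)
        * Real.exp (-((1 - 1 / 2) * δ₀ * (geom D).dist y y')))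
      (fun y y' => by positivity) fun y' lam B hlam p => ?_
    refine (hZ k Mh R hMh hR P hP D a c haw hcw μ y' lam B hlam p).trans ?_
    refine mul_le_mul_of_nonneg_right (mul_le_mul_of_nonneg_left (Real.exp_le_exp.2 ?_) (by positivity)) hlam.nonneg
    have h1 : (1 - 1 / 2) * δ₀ ≤ δZ / (d + 1) := by linarith
    nlinarith [hdnn (blkB D p) y', h1]
  -- the products `Ψ · Λ^{−1}(Rᵀ)ⁿG′∂ᵀ` (left convolution: full rate against `½δ₀`)
  have hprod : ∀ n : ℕ, HasMajorant (g := geom D) (Sum.elim (blkB D) (blkOf D))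
      (liftL (dualOp D α ((rML D a c hP)ᵀ * levW D 1))
        * liftR (Y := BPair D) (Matrix.toLin' (levW D (-1) * (((rML D a c hP)ᵀ) ^ n
          * (gml (N0 ℓ Mh k P) ℓ k D.lev a * (dMat (N0 ℓ Mh k P) μ)ᵀ)))))
      (fun y y' => AΨ * c₁ * (((ℓ : ℝ) + 1) ^ y.1.1) ^ (1 - α) * (C * (1 / 2) ^ n)
        * Real.exp (-((1 - 1 / 2) * δ₀ * (geom D).dist y y'))) := fun n =>
    majorant_G0_mul_265W (g := geom D) (Sum.elim (blkB D) (blkOf D)) c₁ δ₀ (1 / 2) AΨ (C * (1 / 2) ^ n)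
      (fun y => (((ℓ : ℝ) + 1) ^ y.1.1) ^ (1 - α)) hAΨ.le (fun y => Real.rpow_nonneg (by positivity) _)
      (by positivity) hαδ htri h261 hΨm
      (hasMajorant_liftR (g := geom D) (blkOf D) (blkB D)
        (K := fun y y' => C * (1 / 2) ^ n * Real.exp (-((1 - 1 / 2) * δ₀ * (geom D).dist y y')))
        (fun y y' => by positivity) (hmaj μ n))
  have he : ∀ y y' : (geom D).Site,
      Real.exp (-((1 - 1 / 2) * δ₀ * (geom D).dist y y')) = Real.exp (-(δ₀ / 2 * (geom D).dist y y')) := by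
    intro y y'; congr 1; ring
  cases N with
  | zero =>
      -- the fifth entry itself: `T = T₀ + Ψ·Ṽ`
      rw [pow_zero, Matrix.one_mul, dual_identity D (c := c) hℓ hR hP hMh1 hapos hcpos hac α ((dMat (N0 ℓ Mh k P) μ)ᵀ)]
      have h0 : HasMajorant (g := geom D) (Sum.elim (blkB D) (blkOf D))
          (liftL (dualOp D α ((rML D a c hP)ᵀ * levW D 1))
            * liftR (Y := BPair D)
              (Matrix.toLin' (levW D (-1) * (gml (N0 ℓ Mh k P) ℓ k D.lev a * (dMat (N0 ℓ Mh k P) μ)ᵀ))))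
          (fun y y' => AΨ * c₁ * (((ℓ : ℝ) + 1) ^ y.1.1) ^ (1 - α) * C
            * Real.exp (-((1 - 1 / 2) * δ₀ * (geom D).dist y y'))) := by
        simpa only [pow_zero, Matrix.one_mul, mul_one] using hprod 0
      have hsum := hasMajorant_add (g := geom D) (Sum.elim (blkB D) (blkOf D)) hZm h0
      refine hasMajorant_mono (g := geom D) (Sum.elim (blkB D) (blkOf D)) hsum fun y y' => ?_
      rw [he, pow_zero, mul_one]
      have hP0 : 0 ≤ (((ℓ : ℝ) + 1) ^ y.1.1) ^ (1 - α) := Real.rpow_nonneg (by positivity) _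
      have he0 : 0 ≤ Real.exp (-(δ₀ / 2 * (geom D).dist y y')) := (Real.exp_pos _).le
      calc AZ * (((ℓ : ℝ) + 1) ^ y.1.1) ^ (1 - α) * Real.exp (-(δ₀ / 2 * (geom D).dist y y'))
            + AΨ * c₁ * (((ℓ : ℝ) + 1) ^ y.1.1) ^ (1 - α) * C * Real.exp (-(δ₀ / 2 * (geom D).dist y y'))
          = (AZ + AΨ * c₁ * C)
              * ((((ℓ : ℝ) + 1) ^ y.1.1) ^ (1 - α) * Real.exp (-(δ₀ / 2 * (geom D).dist y y'))) := by ring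
        _ ≤ (AZ + 2 * AΨ * c₁ * C + 1)
              * ((((ℓ : ℝ) + 1) ^ y.1.1) ^ (1 - α) * Real.exp (-(δ₀ / 2 * (geom D).dist y y'))) :=
            mul_le_mul_of_nonneg_right (by linarith) (mul_nonneg hP0 he0)
        _ = _ := by ring
  | succ n =>
      -- `D_α∘(Rᵀ(Rᵀ)ⁿG′∂ᵀ) = Ψ · Λ^{−1}(Rᵀ)ⁿG′∂ᵀ`
      have hop : liftL (dualOp D α (((rML D a c hP)ᵀ) ^ (n + 1)
            * (gml (N0 ℓ Mh k P) ℓ k D.lev a * (dMat (N0 ℓ Mh k P) μ)ᵀ)))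
          = liftL (dualOp D α ((rML D a c hP)ᵀ * levW D 1))
            * liftR (Y := BPair D) (Matrix.toLin' (levW D (-1) * (((rML D a c hP)ᵀ) ^ n
              * (gml (N0 ℓ Mh k P) ℓ k D.lev a * (dMat (N0 ℓ Mh k P) μ)ᵀ)))) := by
        conv_lhs =>
          rw [pow_succ', Matrix.mul_assoc,
            ← levW_cancel_left D (((rML D a c hP)ᵀ) ^ n
              * (gml (N0 ℓ Mh k P) ℓ k D.lev a * (dMat (N0 ℓ Mh k P) μ)ᵀ)),
            ← Matrix.mul_assoc ((rML D a c hP)ᵀ), dualOp_mul, ← liftL_mul_liftR]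
      rw [hop]
      refine hasMajorant_mono (g := geom D) (Sum.elim (blkB D) (blkOf D)) (hprod n) fun y y' => ?_
      rw [he]
      have hP0 : 0 ≤ (((ℓ : ℝ) + 1) ^ y.1.1) ^ (1 - α) := Real.rpow_nonneg (by positivity) _
      have he0 : 0 ≤ Real.exp (-(δ₀ / 2 * (geom D).dist y y')) := (Real.exp_pos _).le
      have hkey : AΨ * c₁ * (C * (1 / 2) ^ n) ≤ (AZ + 2 * AΨ * c₁ * C + 1) * (1 / 2) ^ (n + 1) := by
        have hre : AΨ * c₁ * (C * (1 / 2) ^ n) = (2 * AΨ * c₁ * C) * (1 / 2) ^ (n + 1) := by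
          rw [pow_succ]; ring
        rw [hre]
        exact mul_le_mul_of_nonneg_right (by linarith) (pow_nonneg (by norm_num) _)
      calc AΨ * c₁ * (((ℓ : ℝ) + 1) ^ y.1.1) ^ (1 - α) * (C * (1 / 2) ^ n)
            * Real.exp (-(δ₀ / 2 * (geom D).dist y y'))
          = AΨ * c₁ * (C * (1 / 2) ^ n)
              * ((((ℓ : ℝ) + 1) ^ y.1.1) ^ (1 - α) * Real.exp (-(δ₀ / 2 * (geom D).dist y y'))) := by ring
        _ ≤ (AZ + 2 * AΨ * c₁ * C + 1) * (1 / 2) ^ (n + 1)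
              * ((((ℓ : ℝ) + 1) ^ y.1.1) ^ (1 - α) * Real.exp (-(δ₀ / 2 * (geom D).dist y y'))) :=
            mul_le_mul_of_nonneg_right hkey (mul_nonneg hP0 he0)
        _ = _ := by ring

/-- **THE HÖLDER REMAINDER OF THE FIFTH ENTRY READ BACK ON THE PAIRS** (same constants): for all `x ≠ x̂` of one block
`B^j(y)`, `λ` supported in `B^{j′}(y′)` and every `N`, with `W_N = (Rᵀ)^N G′∂_μᵀ = (G′R^N)ᵀ∂_μᵀ`:
`|x̂−x|_∞^{−α}·|(W_Nλ)(x̂) − (W_Nλ)(x)| ≤ C·2^{−N}·(L^{j})^{1−α}·e^{−½δ₀d(y,y′)}·|λ|`.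
[cite: Balaban1984PropagatorsII, Proposition 2.2 p.234 (convergence clause, fifth entry), (2.50) p.232; Balaban1983RegularityDecay, Theorem (1.9) p.573] -/
theorem prop22_series_fifth_pointwise_multiLevelBox_unif (d ℓ : ℕ) (hℓ : 1 ≤ ℓ) (aminus aplus a2minus a2plus : ℝ)
    (ha : 0 < aminus) (ha2 : 0 < a2minus) :
    ∃ δ₀ M₀ : ℝ, ∃ N₀ : ℕ, 0 < δ₀ ∧ 0 < M₀ ∧ 0 < N₀ ∧ ∀ (α : ℝ), 0 ≤ α → α < 1 → ∃ C : ℝ, 0 < C ∧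
      ∀ (k Mh R : ℕ), 3 ≤ Mh → M₀ ≤ ((ℓ : ℝ) + 1) * Mh → 2 * (ℓ + 1) ≤ R → N₀ + 1 ≤ R * ((ℓ + 1) * Mh) →
      ∀ (P : Fin (d + 1) → ℕ) (hP : ∀ μ, 1 ≤ P μ) (D : Domains d ℓ Mh k P R) (a c : ℕ → ℝ),
        (∀ i, 1 ≤ i → aminus ≤ a i ∧ a i ≤ aplus) → (∀ i, 1 ≤ i → a2minus ≤ c i ∧ c i ≤ a2plus) →
        (∀ i, 1 ≤ i → a (i + 1) = aNext ℓ (a i) (c i)) →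
        ∀ (μ : Fin (d + 1)) (N : ℕ) (y' : ↥(bset D)) (lam : ↥(boxDom (N0 ℓ Mh k P)) → ℝ) (B : ℝ),
          BlockSupp (g := geom D) (blkOf D) lam y' B →
          ∀ (x x' : ↥(boxDom (N0 ℓ Mh k P))), x'.1 ≠ x.1 → blkOf D x' = blkOf D x →
            (supNorm (x'.1 - x.1)) ^ (-α)
                * |(((((rML D a c hP)ᵀ) ^ N * (gml (N0 ℓ Mh k P) ℓ k D.lev a * (dMat (N0 ℓ Mh k P) μ)ᵀ))) *ᵥ lam) x'
                    - (((((rML D a c hP)ᵀ) ^ N * (gml (N0 ℓ Mh k P) ℓ k D.lev a * (dMat (N0 ℓ Mh k P) μ)ᵀ))) *ᵥ lam) x|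
              ≤ C * (1 / 2) ^ N * (((ℓ : ℝ) + 1) ^ D.lev x.1) ^ (1 - α)
                * Real.exp (-(δ₀ / 2 * (geom D).dist (blkOf D x) y')) * B := by
  obtain ⟨δ₀, M₀, N₀, hδ₀, hM₀, hN₀, hCA⟩ :=
    prop22_series_fifth_multiLevelBox_unif d ℓ hℓ aminus aplus a2minus a2plus ha ha2
  refine ⟨δ₀, M₀, N₀, hδ₀, hM₀, hN₀, fun α hα0 hα1 => ?_⟩
  obtain ⟨C, hC, h⟩ := hCA α hα0 hα1
  refine ⟨C, hC, ?_⟩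
  intro k Mh R hMh hM hR hRM P hP D a c haw hcw hac μ N y' lam B hlam x x' hne hblk
  have hmaj := h k Mh R hMh hM hR hRM P hP D a c haw hcw hac μ N
  have hrow := rowBound_of_hasMajorant_liftL (g := geom D) (blkOf D) (blkB D) hmaj y' lam B hlam
    (⟨x, x', hne, hblk⟩ : BPair D)
  rw [dualOp_apply, abs_mul, abs_of_nonneg (Real.rpow_nonneg (supNorm_nonneg _) _)] at hrow
  exact hrow

end Fifth

/-! ## §5 The sixth entry: `(−Δ^N)(G′R^N) = R^N − Q′*aQ′(G′R^N)` -/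

section Sixth

variable {ℓ Mh k R : ℕ} {P : Fin (d + 1) → ℕ}

/-- **[B6] PROPOSITION 2.2, CONVERGENCE CLAUSE, SIXTH ENTRY (`Δ^ηG′λ`), GENUINE `k`-LEVEL OPERATOR**: there are
`δ₀, C, M₀ > 0`, `N₀ ≥ 1` such that for every `k`, `M_h ≥ 3`, `L·M_h ≥ M₀`, `R ≥ 2L`, `RM ≥ N₀ + 1`, volume, nested family,
weights in the windows (`a_{i+1} = aNext ℓ a_i c_i`) and EVERY `N`: `(−Δ^N)(G′R^N) = (−Δ^N)(G′ − G′₀Σ_{n<N}Rⁿ)` has majorant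
`C·2^{−N}·e^{−½δ₀d(y,y′)}` on the blocks (print's factor «1»; `N = 0`: the sixth entry itself) — `(−Δ^N)G′ = 1 − Q′*aQ′G′`
(`Δ′_aG′ = 1`, file 7), so `(−Δ^N)(G′R^N) = R^N − Q′*aQ′(G′R^N)`: the chain `R^N` ((2.65), `θc ≤ ½`) and the block average
`Q′*aQ′` (`a_j(L^j)^{−2}` on the `L^{j(d+1)}` sites of the `j`-block) of the remainder of part 1 in the first norm
(`C·2^{−N}·L^{2j}`).
[cite: Balaban1984PropagatorsII, Proposition 2.2 p.234 (convergence clause; sixth entry «1»), (2.50) p.232, (2.13)–(2.14) p.225, (2.64)–(2.66) p.234] -/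
theorem prop22_series_sixth_multiLevelBox (d ℓ : ℕ) (hℓ : 1 ≤ ℓ) (aminus aplus a2minus a2plus : ℝ) (ha : 0 < aminus)
    (ha2 : 0 < a2minus) :
    ∃ δ₀ C M₀ : ℝ, ∃ N₀ : ℕ, 0 < δ₀ ∧ 0 < C ∧ 0 < M₀ ∧ 0 < N₀ ∧
      ∀ (k Mh R : ℕ), 3 ≤ Mh → M₀ ≤ ((ℓ : ℝ) + 1) * Mh → 2 * (ℓ + 1) ≤ R → N₀ + 1 ≤ R * ((ℓ + 1) * Mh) →
      ∀ (P : Fin (d + 1) → ℕ) (hP : ∀ μ, 1 ≤ P μ) (D : Domains d ℓ Mh k P R) (a c : ℕ → ℝ),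
        (∀ i, 1 ≤ i → aminus ≤ a i ∧ a i ≤ aplus) → (∀ i, 1 ≤ i → a2minus ≤ c i ∧ c i ≤ a2plus) →
        (∀ i, 1 ≤ i → a (i + 1) = aNext ℓ (a i) (c i)) → ∀ N : ℕ,
        HasMajorant (g := geom D) (blkOf D)
          (Matrix.toLin' (opBoxR 1 0 0 1 (N0 ℓ Mh k P) * (gml (N0 ℓ Mh k P) ℓ k D.lev a * rML D a c hP ^ N)))
          (fun y y' => C * (1 / 2) ^ N * Real.exp (-(δ₀ / 2 * (geom D).dist y y'))) := by
  obtain ⟨δ₁, C₁, M₁, N₁, hδ₁, hC₁, hM₁, hN₁, hfirst⟩ :=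
    prop22_series_first_multiLevelBox d ℓ hℓ aminus aplus a2minus a2plus ha ha2
  obtain ⟨δR, K, hδR, hK, hRmaj⟩ := rML_majorant d ℓ hℓ aminus aplus a2minus a2plus ha ha2
  have hL0 : (0 : ℝ) < (ℓ : ℝ) + 1 := by positivity
  have hL1 : (1 : ℝ) ≤ (ℓ : ℝ) + 1 := by linarith [(Nat.cast_nonneg ℓ : (0 : ℝ) ≤ ℓ)]
  -- the rate of the chain `R^N` and its (2.59)-threshold
  set δ₂ : ℝ := δR / (d + 1) with hδ₂
  have hδ₂pos : 0 < δ₂ := by rw [hδ₂]; exact div_pos hδR (by positivity)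
  set N₂ : ℕ := ⌈4 * ((d : ℝ) + 1) * ((ℓ : ℝ) + 1) / (1 / 2 * δ₂)⌉₊ + 1 with hN₂
  have hN₂pos : 0 < N₂ := by rw [hN₂]; omega
  have hθlt : Real.exp (-(1 / 2 * δ₂)) * ((ℓ : ℝ) + 1) ^ ((2 * (d + 1 : ℕ) : ℝ) / N₂) < 1 := by
    refine theta_lt_one_of_log hL0 hN₂pos ?_
    have hlog : Real.log ((ℓ : ℝ) + 1) ≤ (ℓ : ℝ) + 1 := (Real.log_le_sub_one_of_pos hL0).trans (by linarith)
    have hN₂ge : 4 * ((d : ℝ) + 1) * ((ℓ : ℝ) + 1) / (1 / 2 * δ₂) < (N₂ : ℝ) := by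
      rw [hN₂]; push_cast
      exact lt_of_le_of_lt (Nat.le_ceil _) (by linarith)
    have hσ : (0 : ℝ) < 1 / 2 * δ₂ := by positivity
    rw [div_lt_iff₀ hσ] at hN₂ge
    push_cast
    nlinarith [mul_nonneg (by positivity : (0 : ℝ) ≤ 2 * ((d : ℝ) + 1)) (Real.log_nonneg hL1)]
  set cK : ℝ := K261 N₂ (d + 1) ((ℓ : ℝ) + 1) 1 (1 / 2 * δ₂) with hcK
  have hcK0 : 0 ≤ cK := K261_nonneg (by positivity) zero_le_one
  set δ₀ : ℝ := min δ₁ δ₂ with hδ₀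
  have hδ₀pos : 0 < δ₀ := lt_min hδ₁ hδ₂pos
  refine ⟨δ₀, |aplus| * C₁ + 2, max M₁ (2 * K * cK + 1), N₁ + N₂, hδ₀pos, by positivity,
    lt_of_lt_of_le hM₁ (le_max_left _ _), by omega, ?_⟩
  intro k Mh R hMh hM hR hRM P hP D a c haw hcw hac N y' lam B hlam x
  have hMh1 : 1 ≤ Mh := le_trans (by norm_num) hMh
  have hMpos : (0 : ℝ) < ((ℓ : ℝ) + 1) * Mh := by
    have : (1 : ℝ) ≤ Mh := by exact_mod_cast hMh1
    positivity
  have hM1 : M₁ ≤ ((ℓ : ℝ) + 1) * Mh := (le_max_left _ _).trans hM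
  have hM2 : 2 * K * cK + 1 ≤ ((ℓ : ℝ) + 1) * Mh := (le_max_right _ _).trans hM
  have hRM1 : N₁ + 1 ≤ R * ((ℓ + 1) * Mh) := le_trans (by omega) hRM
  have hRM2 : N₂ + 1 ≤ R * ((ℓ + 1) * Mh) := le_trans (by omega) hRM
  have hapos : ∀ j, 1 ≤ j → 0 < a j := fun j hj => lt_of_lt_of_le ha (haw j hj).1
  obtain ⟨-, hrefl, hdnn⟩ := triangle_refl_nonneg D hMh1 hP
  have hB0 : 0 ≤ B := hlam.nonneg
  set e0 : ℝ := Real.exp (-(δ₀ / 2 * (geom D).dist (blkOf D x) y')) with he0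
  have he0pos : 0 < e0 := Real.exp_pos _
  have hrate : ∀ δ : ℝ, δ₀ ≤ δ → ∀ y : (geom D).Site,
      Real.exp (-(δ / 2 * (geom D).dist y y')) ≤ Real.exp (-(δ₀ / 2 * (geom D).dist y y')) := fun δ hδ y =>
    Real.exp_le_exp.2 (by nlinarith [hdnn y y'])
  -- the remainder `G′R^N` in the first norm (part 1), on the block of `x`
  have hG := (hfirst k Mh R hMh hM1 hR hRM1 P hP D a c haw hcw hac N).2
  have hgz : ∀ z, blkOf D z = blkOf D x →
      |((gml (N0 ℓ Mh k P) ℓ k D.lev a * rML D a c hP ^ N) *ᵥ lam) z|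
        ≤ C₁ * (1 / 2) ^ N * ((ℓ : ℝ) + 1) ^ (2 * D.lev x.1) * e0 * B := by
    intro z hz
    have h := hG y' lam B hlam z
    rw [Matrix.toLin'_apply, hz] at h
    refine h.trans (mul_le_mul_of_nonneg_right ?_ hB0)
    exact mul_le_mul_of_nonneg_left (hrate δ₁ (min_le_left _ _) _) (by positivity)
  -- the chain `R^N` ((2.65) with `θc ≤ ½`)
  set θ : ℝ := K / (((ℓ : ℝ) + 1) * Mh) with hθ
  have hθ0 : 0 ≤ θ := by positivity
  have hRm : HasMajorant (g := geom D) (blkOf D) (Matrix.toLin' (rML D a c hP))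
      (fun y y' => θ * Real.exp (-(δ₂ * (geom D).dist y y'))) :=
    hRmaj k Mh R hMh hR P hP D a c haw hcw
  obtain ⟨-, -, -, h263⟩ := lemma21_box D hMh1 hP hN₂pos hRM2 hδ₂pos.le (α := 1 / 2) (by norm_num)
    (by norm_num) hθlt
  have hsmall : θ * cK ≤ 1 / 2 := by
    rw [hθ, div_mul_eq_mul_div, div_le_iff₀ hMpos]
    nlinarith
  have hq0 : 0 ≤ θ * cK := mul_nonneg hθ0 hcK0
  have hRN := majorant_pow_265W (g := geom D) (blkOf D) cK δ₂ (1 / 2) θ hθ0 hrefl h263 hRm N y' lam B hlam x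
  rw [← Matrix.toLin'_pow, Matrix.toLin'_apply] at hRN
  have hRx : |(rML D a c hP ^ N *ᵥ lam) x| ≤ (1 / 2) ^ N * e0 * B := by
    refine hRN.trans (mul_le_mul_of_nonneg_right ?_ hB0)
    have h1 : Real.exp (-((1 - 1 / 2) * δ₂ * (geom D).dist (blkOf D x) y')) ≤ e0 := by
      rw [he0]; exact Real.exp_le_exp.2 (by nlinarith [hdnn (blkOf D x) y', min_le_right δ₁ δ₂])
    exact mul_le_mul (pow_le_pow_left₀ hq0 hsmall N) h1 (Real.exp_pos _).le (pow_nonneg (by norm_num) N)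
  -- `(−Δ^N)(G′R^N) = R^N − Q′*aQ′(G′R^N)`
  have hmat : opBoxR 1 0 0 1 (N0 ℓ Mh k P) * (gml (N0 ℓ Mh k P) ℓ k D.lev a * rML D a c hP ^ N)
      = rML D a c hP ^ N - vOp (N0 ℓ Mh k P) ℓ k D.lev a * (gml (N0 ℓ Mh k P) ℓ k D.lev a * rML D a c hP ^ N) := by
    rw [← Matrix.mul_assoc, lap_mul_gml D hP hMh1 hapos, Matrix.sub_mul, Matrix.one_mul, Matrix.mul_assoc]
  rw [Matrix.toLin'_apply, hmat, Matrix.sub_mulVec, Pi.sub_apply, ← Matrix.mulVec_mulVec]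
  -- the block average of the remainder
  have hV := vOp_mulVec_abs_le D (fun j hj => (hapos j hj).le) _ x hgz
  have hlevx : 1 ≤ D.lev x.1 := D.one_le_lev x.1
  have hax : a (D.lev x.1) ≤ |aplus| := (haw _ hlevx).2.trans (le_abs_self _)
  have hLpow : (0 : ℝ) < (((ℓ : ℝ) + 1) ^ D.lev x.1) ^ 2 := by positivity
  have hV' : |(vOp (N0 ℓ Mh k P) ℓ k D.lev a *ᵥ
        ((gml (N0 ℓ Mh k P) ℓ k D.lev a * rML D a c hP ^ N) *ᵥ lam)) x|
      ≤ |aplus| * C₁ * (1 / 2) ^ N * e0 * B := by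
    refine hV.trans ?_
    have hsimp : a (D.lev x.1) * ((((ℓ : ℝ) + 1) ^ D.lev x.1) ^ 2)⁻¹
          * (C₁ * (1 / 2) ^ N * ((ℓ : ℝ) + 1) ^ (2 * D.lev x.1) * e0 * B)
        = a (D.lev x.1) * (C₁ * (1 / 2) ^ N * e0 * B) := by
      rw [pow_mul']
      field_simp
    rw [hsimp]
    calc a (D.lev x.1) * (C₁ * (1 / 2) ^ N * e0 * B) ≤ |aplus| * (C₁ * (1 / 2) ^ N * e0 * B) :=
          mul_le_mul_of_nonneg_right hax (by positivity)
      _ = |aplus| * C₁ * (1 / 2) ^ N * e0 * B := by ring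
  calc |(rML D a c hP ^ N *ᵥ lam) x - (vOp (N0 ℓ Mh k P) ℓ k D.lev a *ᵥ
          ((gml (N0 ℓ Mh k P) ℓ k D.lev a * rML D a c hP ^ N) *ᵥ lam)) x|
      ≤ |(rML D a c hP ^ N *ᵥ lam) x| + |(vOp (N0 ℓ Mh k P) ℓ k D.lev a *ᵥ
          ((gml (N0 ℓ Mh k P) ℓ k D.lev a * rML D a c hP ^ N) *ᵥ lam)) x| := abs_sub _ _
    _ ≤ (1 / 2) ^ N * e0 * B + |aplus| * C₁ * (1 / 2) ^ N * e0 * B := add_le_add hRx hV'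
    _ = (|aplus| * C₁ + 1) * (1 / 2) ^ N * e0 * B := by ring
    _ ≤ (|aplus| * C₁ + 2) * (1 / 2) ^ N * e0 * B := by
        have : 0 ≤ (1 / 2 : ℝ) ^ N * e0 * B := by positivity
        nlinarith

end Sixth

end

end Literature.MathematicalPhysics.QuantumFieldTheory.Balaban1983to89.B6Prop22SeriesAdjMultiLevelBox
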